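import Mathlib.Geometry.Euclidean.Angle.Unoriented.TriangleInequality
import Mathlib.Analysis.SpecialFunctions.Trigonometric.Inverse
import Mathlib.Analysis.Real.Pi.Bounds
import Literature.Geometry.DiscreteGeometry.SphericalExcessEuler
import Literature.Geometry.DiscreteGeometry.KissingAngleBounds
import HarnessLib

/-!
# Angles subtended at a point by the sides of a spherical polygon: the three metric lemmas behind
# the rattler prune (d1)(d2) of the GAP census (`DESIGN-L12-THEORY.md` §P-L3 (d), T2 §14)

HONEST FRAMING. Part of the venture `Summits/Ventures/Crystal3D` (cell `pub-crystal3d`, phase 2;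
seat p3), generic and configuration-free: `V` is any real inner product space; nothing here
mentions GAP(1.26). The census prune "rattlers lie only inside `p`-hexagons" (theory-2 §14, cell
file `phase2/ENV-CENSUS/DESIGN-L12-THEORY.md` §P-L3 (d1)(d2)) rests on three elementary facts,
proved here once and for all:

* **winding** `two_pi_le_angle_add_angle_add_angle` — three nonzero vectors with a vanishing
  nonnegative (nontrivial) combination pairwise subtend angles summing to `≥ 2π` (for a unit `z`
  in the cone of a spherical triangle `abc`, applied to the tangential projections `perpTo z ·`
  of `a, b, c`: the sides of the triangle subtend `≥ 2π` at `z`); the chain form of the triangle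
  inequality for angles `angle_le_sum_angle` lifts this from a triangle to any polygon containing
  it (`Bulk/HullFaceSubtended*.lean`);
* **inner path** (§14.3, base case) `angle_add_angle_le_of_mem_cone3` — for `z` in the cone of
  `a, b, c`: `∠(z,a) + ∠(z,b) ≤ ∠(c,a) + ∠(c,b)` (spherical distances `∠ = InnerProductGeometry.angle`);
* **Lemma 14.1** `angle_perpTo_le_arccos_third` — a `60°` side `vw` (`⟪v,w⟫ = 1/2`) seen from a
  unit `z` at spherical distances `a, b ≥ 60°` with `a + b ≤ 240°` subtends an angle `≤ α₀ =
  arccos (1/3)` (identity `3 cos a cos b + sin a sin b = cos (a+b) + 2 cos (a−b) ≤ 3/2`);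
  and the count `five_mul_arccos_third_lt_two_pi` (`5 α₀ < 2π`: five such sides cannot wind once
  around `z` — no rattler in an `x`-pentagon, -rhombus or -triangle).

Small conversions for unit vectors (`angle_eq_arccos_inner_of_norm_one`,
`pi_div_three_le_angle_of_inner_le_half`, `angle_eq_pi_div_three_of_inner_eq_half`) are included.
Lemma 14.2 (the `ρ`-sides at the hole, with the `U(ρ)` numerics) is NOT here.
-/

noncomputable section

namespace Summit.Ventures.Crystal3D

open Literature.Geometry.DiscreteGeometry Real InnerProductGeometry Finset
open scoped InnerProductSpace

section Generic

variable {V : Type*} [NormedAddCommGroup V] [InnerProductSpace ℝ V]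

/-! ## The chain form of the triangle inequality for angles -/

/-- **Chain inequality.** `∠(f i, f j) ≤ Σ_{t ∈ [i, j)} ∠(f t, f (t+1))` for `i < j`. -/
theorem angle_le_sum_angle (f : ℕ → V) {i j : ℕ} (hij : i < j) :
    angle (f i) (f j) ≤ ∑ t ∈ Ico i j, angle (f t) (f (t + 1)) := by
  induction j with
  | zero => exact absurd hij (Nat.not_lt_zero _)
  | succ j ih =>
    rcases Nat.lt_succ_iff_lt_or_eq.1 hij with h | h
    · rw [Finset.sum_Ico_succ_top (le_of_lt h)]
      exact (angle_le_angle_add_angle (f i) (f j) (f (j + 1))).trans (by linarith [ih h])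
    · subst h
      rw [Finset.sum_Ico_succ_top le_rfl, Finset.Ico_self, Finset.sum_empty, zero_add]

/-! ## Winding: a point in a triangle sees its sides under a total angle `≥ 2π` -/

/-- **Winding lemma.** If `p, q, r ≠ 0` admit a vanishing combination `a p + b q + c r = 0` with
`a, b, c ≥ 0` not all zero, then `∠(p,q) + ∠(q,r) + ∠(r,p) ≥ 2π` (in fact `= 2π` unless two of
them are opposite). Applied to the tangential projections at a point `z` of a spherical triangle
containing `z`. -/
theorem two_pi_le_angle_add_angle_add_angle {p q r : V} (hp : p ≠ 0) (hq : q ≠ 0) (hr : r ≠ 0)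
    {a b c : ℝ} (ha : 0 ≤ a) (hb : 0 ≤ b) (hc : 0 ≤ c) (habc : 0 < a + b + c)
    (h0 : a • p + b • q + c • r = 0) :
    2 * π ≤ angle p q + angle q r + angle r p := by
  rcases hc.eq_or_lt with hc0 | hc0
  · -- `c = 0`: `a p = − b q` with `a, b > 0`, so `∠(p,q) = π`
    subst hc0
    rw [zero_smul, add_zero] at h0
    have ha0 : 0 < a := by
      rcases ha.eq_or_lt with h | h
      · subst h
        rw [zero_smul, zero_add] at h0
        have hb0 : 0 < b := by linarith
        exact absurd ((smul_eq_zero.1 h0).resolve_left hb0.ne') hq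
      · exact h
    have hb0 : 0 < b := by
      rcases hb.eq_or_lt with h | h
      · subst h
        rw [zero_smul, add_zero] at h0
        exact absurd ((smul_eq_zero.1 h0).resolve_left ha0.ne') hp
      · exact h
    have hpq : p = -((b / a) • q) := by
      have : a • p = -(b • q) := eq_neg_of_add_eq_zero_left h0
      calc p = a⁻¹ • (a • p) := by rw [smul_smul, inv_mul_cancel₀ ha0.ne', one_smul]
        _ = -((b / a) • q) := by rw [this, smul_neg, smul_smul, div_eq_inv_mul]
    have h1 : angle p q = π := by
      rw [hpq, angle_neg_left, angle_smul_left_of_pos _ _ (div_pos hb0 ha0), angle_self hq, sub_zero]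
    have h2 : angle q p ≤ angle q r + angle r p := angle_le_angle_add_angle q r p
    rw [angle_comm q p, h1] at h2
    linarith
  · -- `c > 0`: `y = a p + b q = c • (−r)` lies in the cone of `p, q`
    set y := a • p + b • q with hy
    have hyr : y = c • (-r) := by
      rw [smul_neg, eq_neg_iff_add_eq_zero]; exact h0
    have hy0 : y ≠ 0 := by
      rw [hyr]; exact smul_ne_zero hc0.ne' (neg_ne_zero.2 hr)
    have hmem : y ∈ Submodule.span NNReal {p, q} := by
      rw [Submodule.mem_span_pair]
      exact ⟨⟨a, ha⟩, ⟨b, hb⟩, rfl⟩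
    have hsplit := angle_eq_angle_add_add_angle_add_of_mem_span hy0 hmem
    have h1 : angle p y = π - angle p r := by
      rw [hyr, angle_smul_right_of_pos _ _ hc0, angle_neg_right]
    have h2 : angle y q = π - angle r q := by
      rw [hyr, angle_smul_left_of_pos _ _ hc0, angle_neg_left]
    rw [h1, h2] at hsplit
    rw [angle_comm q r, angle_comm r p]
    linarith

/-! ## The inner path: two sides of an inner triangle are shorter than two sides of the outer -/

/-- **Inner path (§14.3, base case).** If `z ≠ 0` lies in the closed cone of `a, b, c`, then
`∠(z,a) + ∠(z,b) ≤ ∠(c,a) + ∠(c,b)`: the broken geodesic `a → z → b` is at most `a → c → b`. -/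
theorem angle_add_angle_le_of_mem_cone3 {a b c z : V} (hz : z ≠ 0) {α β γ : ℝ} (hα : 0 ≤ α)
    (hβ : 0 ≤ β) (hγ : 0 ≤ γ) (h : z = α • a + β • b + γ • c) :
    angle z a + angle z b ≤ angle c a + angle c b := by
  set y := β • b + γ • c with hy
  have hz' : z = α • a + y := by rw [h, hy, add_assoc]
  by_cases hy0 : y = 0
  · -- `z = α a` with `α > 0`
    rw [hy0, add_zero] at hz'
    have hα0 : 0 < α := by
      rcases hα.eq_or_lt with h' | h'
      · rw [← h', zero_smul] at hz'; exact absurd hz' hz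
      · exact h'
    have ha0 : a ≠ 0 := by
      intro ha; rw [ha, smul_zero] at hz'; exact hz hz'
    rw [hz', angle_smul_left_of_pos _ _ hα0, angle_smul_left_of_pos _ _ hα0, angle_self ha0,
      zero_add, angle_comm c a]
    exact angle_le_angle_add_angle a c b
  · have hmem1 : z ∈ Submodule.span NNReal {a, y} := by
      rw [Submodule.mem_span_pair]
      refine ⟨⟨α, hα⟩, 1, ?_⟩
      rw [one_smul, hz']; rfl
    have hmem2 : y ∈ Submodule.span NNReal {b, c} := by
      rw [Submodule.mem_span_pair]
      exact ⟨⟨β, hβ⟩, ⟨γ, hγ⟩, rfl⟩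
    have h1 := angle_eq_angle_add_add_angle_add_of_mem_span hz hmem1
    have h2 := angle_eq_angle_add_add_angle_add_of_mem_span hy0 hmem2
    have h3 := angle_le_angle_add_angle z y b
    have h4 := angle_le_angle_add_angle a c y
    rw [angle_comm z a, angle_comm c b, angle_comm c a, h2, angle_comm b y]
    rw [angle_comm c y] at h4
    linarith

/-! ## Unit vectors: angles as `arccos` of inner products -/

/-- For unit vectors, `∠(x,y) = arccos ⟪x,y⟫`. -/
theorem angle_eq_arccos_inner_of_norm_one {x y : V} (hx : ‖x‖ = 1) (hy : ‖y‖ = 1) :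
    angle x y = arccos ⟪x, y⟫_ℝ := by
  unfold angle; rw [hx, hy, mul_one, div_one]

/-- `arccos (1/2) = π/3`, inlined (no new root lemma). -/
private theorem arccos_half : arccos (1 / 2 : ℝ) = π / 3 := by
  rw [← Real.cos_pi_div_three, Real.arccos_cos (by positivity) (by linarith [Real.pi_pos])]

/-- Unit vectors at inner product `≤ 1/2` are at spherical distance `≥ π/3`. -/
theorem pi_div_three_le_angle_of_inner_le_half {x y : V} (hx : ‖x‖ = 1) (hy : ‖y‖ = 1)
    (h : ⟪x, y⟫_ℝ ≤ 1 / 2) : π / 3 ≤ angle x y := by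
  rw [angle_eq_arccos_inner_of_norm_one hx hy, ← arccos_half]
  exact Real.arccos_le_arccos h

/-- Unit vectors at inner product `1/2` are at spherical distance `π/3`. -/
theorem angle_eq_pi_div_three_of_inner_eq_half {x y : V} (hx : ‖x‖ = 1) (hy : ‖y‖ = 1)
    (h : ⟪x, y⟫_ℝ = 1 / 2) : angle x y = π / 3 := by
  rw [angle_eq_arccos_inner_of_norm_one hx hy, h, arccos_half]

/-! ## Lemma 14.1: a `60°` side seen from afar subtends at most `α₀ = arccos (1/3)` -/

/-- The trigonometric identity `3 cos a cos b + sin a sin b = cos (a + b) + 2 cos (a − b)`. -/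
theorem three_mul_cos_mul_cos_add (a b : ℝ) :
    3 * cos a * cos b + sin a * sin b = cos (a + b) + 2 * cos (a - b) := by
  rw [Real.cos_add, Real.cos_sub]; ring

/-- `cos θ ≤ −1/2` for `θ ∈ [2π/3, 4π/3]`. -/
theorem cos_le_neg_half_of_mem {θ : ℝ} (h1 : 2 * π / 3 ≤ θ) (h2 : θ ≤ 4 * π / 3) :
    cos θ ≤ -(1 / 2) := by
  have e : cos θ = -cos (θ - π) := by
    rw [show θ = (θ - π) + π by ring, Real.cos_add_pi]; ring_nf
  have habs : |θ - π| ≤ π / 3 := abs_le.2 ⟨by linarith, by linarith⟩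
  have hcos : cos (π / 3) ≤ cos (|θ - π|) :=
    Real.cos_le_cos_of_nonneg_of_le_pi (abs_nonneg _) (by linarith [Real.pi_pos]) habs
  rw [Real.cos_abs, Real.cos_pi_div_three] at hcos
  linarith

/-- **Lemma 14.1 (theory-2 §14).** Unit vectors `z, v, w` with `⟪v,w⟫ = 1/2` (a `60°` side),
`⟪z,v⟫ ≤ 1/2`, `⟪z,w⟫ ≤ 1/2` (the point `z` is `≥ 60°` from both ends) and
`∠(z,v) + ∠(z,w) ≤ 4π/3`: the angle subtended at `z` by the side `vw` — the angle between the
tangential projections `perpTo z v`, `perpTo z w` — is at most `α₀ = arccos (1/3)`. -/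
theorem angle_perpTo_le_arccos_third {z v w : V} (hz : ‖z‖ = 1) (hv : ‖v‖ = 1) (hw : ‖w‖ = 1)
    (hvw : ⟪v, w⟫_ℝ = 1 / 2) (hzv : ⟪z, v⟫_ℝ ≤ 1 / 2) (hzw : ⟪z, w⟫_ℝ ≤ 1 / 2)
    (hsum : angle z v + angle z w ≤ 4 * π / 3) :
    angle (perpTo z v) (perpTo z w) ≤ arccos (1 / 3) := by
  set x := ⟪z, v⟫_ℝ with hx
  set y := ⟪z, w⟫_ℝ with hy
  have hav : angle z v = arccos x := angle_eq_arccos_inner_of_norm_one hz hv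
  have haw : angle z w = arccos y := angle_eq_arccos_inner_of_norm_one hz hw
  have hx1 : -1 ≤ x := by
    have := abs_real_inner_le_norm z v; rw [hz, hv, mul_one] at this; exact (abs_le.1 this).1
  have hy1 : -1 ≤ y := by
    have := abs_real_inner_le_norm z w; rw [hz, hw, mul_one] at this; exact (abs_le.1 this).1
  -- the projections
  have hin : ⟪perpTo z v, perpTo z w⟫_ℝ = 1 / 2 - x * y := by
    rw [inner_perpTo_perpTo_of_norm_eq_one hz, hvw]
  have hnv : ‖perpTo z v‖ = Real.sqrt (1 - x ^ 2) := by
    rw [← Real.sqrt_sq (norm_nonneg _), norm_perpTo_sq_of_norm_eq_one hz hv]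
  have hnw : ‖perpTo z w‖ = Real.sqrt (1 - y ^ 2) := by
    rw [← Real.sqrt_sq (norm_nonneg _), norm_perpTo_sq_of_norm_eq_one hz hw]
  -- the distances `a = arccos x`, `b = arccos y` lie in `[π/3, π]`
  have ha3 : π / 3 ≤ arccos x := hav ▸ pi_div_three_le_angle_of_inner_le_half hz hv hzv
  have hb3 : π / 3 ≤ arccos y := haw ▸ pi_div_three_le_angle_of_inner_le_half hz hw hzw
  rw [hav, haw] at hsum
  -- non-degeneracy: `x, y > −1` (else the other distance is `2π/3` and the sum exceeds `4π/3`)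
  have hcx : cos (arccos x) = x := Real.cos_arccos hx1 (by linarith)
  have hcy : cos (arccos y) = y := Real.cos_arccos hy1 (by linarith)
  have hsx : sin (arccos x) = Real.sqrt (1 - x ^ 2) := Real.sin_arccos x
  have hsy : sin (arccos y) = Real.sqrt (1 - y ^ 2) := Real.sin_arccos y
  have key : 3 * x * y + Real.sqrt (1 - x ^ 2) * Real.sqrt (1 - y ^ 2) ≤ 3 / 2 := by
    have h := three_mul_cos_mul_cos_add (arccos x) (arccos y)
    rw [hcx, hcy, hsx, hsy] at h
    rw [h]
    have h1 : cos (arccos x + arccos y) ≤ -(1 / 2) :=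
      cos_le_neg_half_of_mem (by linarith) (by linarith)
    have h2 : cos (arccos x - arccos y) ≤ 1 := Real.cos_le_one _
    linarith
  have hx1' : -1 < x := by
    rcases hx1.eq_or_lt with h | h
    · exfalso
      have hs : Real.sqrt (1 - x ^ 2) = 0 := by rw [← h]; norm_num
      rw [hs, zero_mul, add_zero, ← h] at key
      -- `y ≤ -1/2`... then `arccos y ≥ 2π/3` and `arccos x = π`: sum `> 4π/3`
      have hy' : y ≤ 1 / 2 := hzw
      have : arccos x = π := by rw [← h, Real.arccos_neg_one]
      have hy2 : -(1 / 2) ≤ y := by linarith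
      -- from `key`: `-3 y ≤ 3/2`, i.e. `y ≥ -1/2`; and the inner product of the projections is `0`
      have hpv : perpTo z v = 0 := by
        rw [← norm_eq_zero, hnv, ← h]; norm_num
      have h0 : 1 / 2 - x * y = 0 := by rw [← hin, hpv, inner_zero_left]
      rw [← h] at h0
      have hyv : y = -(1 / 2) := by linarith
      have : arccos y = 2 * π / 3 := by
        rw [hyv, show (-(1 / 2) : ℝ) = cos (2 * π / 3) by
          rw [show 2 * π / 3 = π - π / 3 by ring, Real.cos_pi_sub, Real.cos_pi_div_three],
          Real.arccos_cos (by positivity) (by linarith [Real.pi_pos])]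
      linarith [Real.pi_pos]
    · exact h
  have hy1' : -1 < y := by
    rcases hy1.eq_or_lt with h | h
    · exfalso
      have hpw : perpTo z w = 0 := by
        rw [← norm_eq_zero, hnw, ← h]; norm_num
      have h0 : 1 / 2 - x * y = 0 := by rw [← hin, hpw, inner_zero_right]
      rw [← h] at h0
      have hxv : x = -(1 / 2) := by linarith
      have e1 : arccos x = 2 * π / 3 := by
        rw [hxv, show (-(1 / 2) : ℝ) = cos (2 * π / 3) by
          rw [show 2 * π / 3 = π - π / 3 by ring, Real.cos_pi_sub, Real.cos_pi_div_three],
          Real.arccos_cos (by positivity) (by linarith [Real.pi_pos])]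
      have e2 : arccos y = π := by rw [← h, Real.arccos_neg_one]
      linarith [Real.pi_pos]
    · exact h
  have hxlt : x < 1 := by linarith
  have hylt : y < 1 := by linarith
  have hpx : 0 < 1 - x ^ 2 := by nlinarith
  have hpy : 0 < 1 - y ^ 2 := by nlinarith
  have hsvx : 0 < Real.sqrt (1 - x ^ 2) := Real.sqrt_pos.2 hpx
  have hsvy : 0 < Real.sqrt (1 - y ^ 2) := Real.sqrt_pos.2 hpy
  -- `cos` of the subtended angle is `≥ 1/3`
  have hcos : (1 : ℝ) / 3 ≤ ⟪perpTo z v, perpTo z w⟫_ℝ / (‖perpTo z v‖ * ‖perpTo z w‖) := by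
    rw [hin, hnv, hnw, le_div_iff₀ (mul_pos hsvx hsvy)]
    linarith
  unfold angle
  exact Real.arccos_le_arccos hcos

/-- **The count behind (d1) for `x`-only faces**: `5 · arccos (1/3) < 2π` — five sides each
subtending `≤ α₀` cannot wind once around a point (and a fortiori three or four). -/
theorem five_mul_arccos_third_lt_two_pi : 5 * arccos (1 / 3) < 2 * π := by
  have h1 := arccos_third_lt
  have h2 := Real.pi_gt_d2
  linarith

end Generic

end Summit.Ventures.Crystal3D
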